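import Summits.QuantumFields.YangMills.Theorems.LuscherReductionOneSiteLevelsGnPotDeriv

/-!
# Gradient bound for the chart factor `h = gnW · gnMag` and for `Φ = c · G · h`
# (support module for the registered stub `stub_absLower` of crux `OneSiteLevels`, route `LuscherReduction`,
# item stmt-QuantumFields-20007; fleet seat prover ym-luscher-20007-p2)

Continuation of `…GnPotDeriv`: the partials of `gnW = Π_i c_i²`, `gnMag = e^{−4B·gnPot}` and `h = gnW·gnMag` along the coordinate
lines, the bound `|∂_p h(y)| ≤ gnLip B μ y = 12μ²‖y‖ + 36Bμ⁴(μ²‖y‖⁵ + 2‖y‖³)` (`abs_pderiv_gnH_le`), `‖∇h‖² ≤ 9·gnLip²`, and the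
pointwise gradient bound for the quasimode integrand `Φ = c·G·h`:
`‖∇Φ‖² ≤ c²[(1+λ)‖∇G‖² + (1+λ⁻¹)·G²·9·gnLip²]` (`norm_gradient_sq_mul_gnH_le`), the input of the flat Gaussian form bound.

## WHAT THIS IS NOT
Calculus only; NOT the stub, NOT THE CLAY GAP.  Sorry-free, no named fact.
-/

set_option autoImplicit false

noncomputable section

open MeasureTheory Filter Topology Real
open scoped Matrix
open Literature.MathematicalPhysics.QuantumFieldTheory
open Literature.MathematicalPhysics.QuantumLattice
open Literature.Analysis.OperatorTheory.YMMatrixModel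

namespace Summit.QuantumFields.YangMills.Theorems.FemtoTransferGap

section LineDeriv

variable (y : ZM) (p : Fin 3 × Fin 3)

/-- `gnW` as an explicit triple product. [folklore] -/
theorem gnW_eq (μ : ℝ) (z : ZM) : gnW μ z = gnC μ z 0 ^ 2 * gnC μ z 1 ^ 2 * gnC μ z 2 ^ 2 := by
  rw [gnW, Fin.prod_univ_three]

/-- The derivative of `gnW μ` along `e_p` at `y`. [folklore] -/
def gnW' (μ : ℝ) : ℝ :=
  2 * gnC μ y 0 * gnC' y p μ 0 * gnC μ y 1 ^ 2 * gnC μ y 2 ^ 2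
    + gnC μ y 0 ^ 2 * (2 * gnC μ y 1 * gnC' y p μ 1) * gnC μ y 2 ^ 2
    + gnC μ y 0 ^ 2 * gnC μ y 1 ^ 2 * (2 * gnC μ y 2 * gnC' y p μ 2)

/-- Derivative of `gnW` along `e_p` at `t = 0`. [folklore] -/
theorem hasDerivAt_gnW_line (μ : ℝ) : HasDerivAt (fun t : ℝ => gnW μ (y + t • unitDir p)) (gnW' y p μ) 0 := by
  have e : (fun t : ℝ => gnW μ (y + t • unitDir p)) = fun t =>
      gnC μ (y + t • unitDir p) 0 ^ 2 * gnC μ (y + t • unitDir p) 1 ^ 2 * gnC μ (y + t • unitDir p) 2 ^ 2 :=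
    funext fun t => gnW_eq μ _
  rw [e]
  have h := (((hasDerivAt_gnC_line y p μ 0).pow 2).mul ((hasDerivAt_gnC_line y p μ 1).pow 2)).mul
    ((hasDerivAt_gnC_line y p μ 2).pow 2)
  refine h.congr_deriv ?_
  simp only [gnW', zero_smul, add_zero, Nat.cast_ofNat, Pi.pow_apply, Pi.mul_apply]
  ring

/-- `|gnW'| ≤ 12μ²‖y‖`. [folklore] -/
theorem abs_gnW'_le (μ : ℝ) : |gnW' y p μ| ≤ 12 * μ ^ 2 * ‖y‖ := by
  have hc : ∀ i, 0 ≤ gnC μ y i ∧ gnC μ y i ≤ 1 := fun i => ⟨(gnC_pos μ y i).le, gnC_le_one μ y i⟩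
  have hc2 : ∀ i, gnC μ y i ^ 2 ≤ 1 := fun i => by have := hc i; nlinarith
  have hd : ∀ i, |gnC' y p μ i| ≤ 2 * μ ^ 2 * ‖y‖ := fun i => abs_gnC'_le y p μ i
  have term : ∀ (a b c d : ℝ), 0 ≤ a → a ≤ 1 → 0 ≤ c → c ≤ 1 → 0 ≤ d → d ≤ 1 → |b| ≤ 2 * μ ^ 2 * ‖y‖ →
      |2 * a * b * c * d| ≤ 4 * μ ^ 2 * ‖y‖ := by
    intro a b c d ha0 ha1 hc0 hc1 hd0 hd1 hb
    rw [abs_mul, abs_mul, abs_mul, abs_mul, abs_two, abs_of_nonneg ha0, abs_of_nonneg hc0, abs_of_nonneg hd0]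
    have : 2 * a * |b| * c * d ≤ 2 * 1 * (2 * μ ^ 2 * ‖y‖) * 1 * 1 := by
      gcongr
    linarith
  unfold gnW'
  have t0 := term (gnC μ y 0) (gnC' y p μ 0) (gnC μ y 1 ^ 2) (gnC μ y 2 ^ 2) (hc 0).1 (hc 0).2 (sq_nonneg _) (hc2 1)
    (sq_nonneg _) (hc2 2) (hd 0)
  have t1 := term (gnC μ y 1) (gnC' y p μ 1) (gnC μ y 0 ^ 2) (gnC μ y 2 ^ 2) (hc 1).1 (hc 1).2 (sq_nonneg _) (hc2 0)
    (sq_nonneg _) (hc2 2) (hd 1)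
  have t2 := term (gnC μ y 2) (gnC' y p μ 2) (gnC μ y 0 ^ 2) (gnC μ y 1 ^ 2) (hc 2).1 (hc 2).2 (sq_nonneg _) (hc2 0)
    (sq_nonneg _) (hc2 1) (hd 2)
  have e1 : gnC μ y 0 ^ 2 * (2 * gnC μ y 1 * gnC' y p μ 1) * gnC μ y 2 ^ 2 =
      2 * gnC μ y 1 * gnC' y p μ 1 * gnC μ y 0 ^ 2 * gnC μ y 2 ^ 2 := by ring
  have e2 : gnC μ y 0 ^ 2 * gnC μ y 1 ^ 2 * (2 * gnC μ y 2 * gnC' y p μ 2) =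
      2 * gnC μ y 2 * gnC' y p μ 2 * gnC μ y 0 ^ 2 * gnC μ y 1 ^ 2 := by ring
  rw [e1, e2]
  calc _ ≤ |2 * gnC μ y 0 * gnC' y p μ 0 * gnC μ y 1 ^ 2 * gnC μ y 2 ^ 2| +
        |2 * gnC μ y 1 * gnC' y p μ 1 * gnC μ y 0 ^ 2 * gnC μ y 2 ^ 2| +
        |2 * gnC μ y 2 * gnC' y p μ 2 * gnC μ y 0 ^ 2 * gnC μ y 1 ^ 2| := abs_add_three _ _ _
    _ ≤ 4 * μ ^ 2 * ‖y‖ + 4 * μ ^ 2 * ‖y‖ + 4 * μ ^ 2 * ‖y‖ := add_le_add (add_le_add t0 t1) t2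
    _ = 12 * μ ^ 2 * ‖y‖ := by ring

/-- The derivative of `gnMag B μ` along `e_p` at `y`. [folklore] -/
def gnMag' (B μ : ℝ) : ℝ := -(4 * B * gnPot' y p μ) * gnMag B μ y

/-- Derivative of `gnMag` along `e_p` at `t = 0`. [folklore] -/
theorem hasDerivAt_gnMag_line (B μ : ℝ) : HasDerivAt (fun t : ℝ => gnMag B μ (y + t • unitDir p)) (gnMag' y p B μ) 0 := by
  unfold gnMag
  have h := ((hasDerivAt_gnPot_line y p μ).const_mul (4 * B)).neg.exp
  refine h.congr_deriv ?_
  simp only [gnMag', gnMag, Pi.neg_apply, zero_smul, add_zero]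
  ring

/-- `|gnMag'| ≤ 4B·|gnPot'|` for `B ≥ 0`. [folklore] -/
theorem abs_gnMag'_le {B : ℝ} (hB : 0 ≤ B) (μ : ℝ) : |gnMag' y p B μ| ≤ 4 * B * (9 * μ ^ 4 * (μ ^ 2 * ‖y‖ ^ 5 + 2 * ‖y‖ ^ 3)) := by
  unfold gnMag'
  rw [abs_mul, abs_neg, abs_mul, abs_of_nonneg (by positivity : (0:ℝ) ≤ 4 * B), abs_of_nonneg (gnMag_pos B μ y).le]
  have h1 := abs_gnPot'_le y p μ
  have h2 := gnMag_le_one hB μ y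
  calc 4 * B * |gnPot' y p μ| * gnMag B μ y ≤ 4 * B * (9 * μ ^ 4 * (μ ^ 2 * ‖y‖ ^ 5 + 2 * ‖y‖ ^ 3)) * 1 :=
        mul_le_mul (mul_le_mul_of_nonneg_left h1 (by positivity)) h2 (gnMag_pos B μ y).le (by positivity)
    _ = _ := mul_one _

/-- **The gradient-size function** `gnLip B μ y = 12μ²‖y‖ + 36Bμ⁴(μ²‖y‖⁵ + 2‖y‖³)`. [folklore] -/
def gnLip (B μ : ℝ) (y : ZM) : ℝ := 12 * μ ^ 2 * ‖y‖ + 36 * B * μ ^ 4 * (μ ^ 2 * ‖y‖ ^ 5 + 2 * ‖y‖ ^ 3)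

/-- `0 ≤ gnLip` for `B ≥ 0`. [folklore] -/
theorem gnLip_nonneg {B : ℝ} (hB : 0 ≤ B) (μ : ℝ) (y : ZM) : 0 ≤ gnLip B μ y := by unfold gnLip; positivity

/-- The derivative of `h = gnW·gnMag` along `e_p` at `y`. [folklore] -/
def gnH' (B μ : ℝ) : ℝ := gnW' y p μ * gnMag B μ y + gnW μ y * gnMag' y p B μ

/-- Derivative of `h` along `e_p` at `t = 0`. [folklore] -/
theorem hasDerivAt_gnH_line (B μ : ℝ) : HasDerivAt (fun t : ℝ => gnH B μ (y + t • unitDir p)) (gnH' y p B μ) 0 := by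
  unfold gnH
  have h := (hasDerivAt_gnW_line y p μ).mul (hasDerivAt_gnMag_line y p B μ)
  refine h.congr_deriv ?_
  simp only [gnH', zero_smul, add_zero]

/-- `|gnH'| ≤ gnLip` for `B ≥ 0`. [folklore] -/
theorem abs_gnH'_le {B : ℝ} (hB : 0 ≤ B) (μ : ℝ) : |gnH' y p B μ| ≤ gnLip B μ y := by
  unfold gnH' gnLip
  have h1 := abs_gnW'_le y p μ
  have h2 := abs_gnMag'_le y p hB μ
  have hm0 := (gnMag_pos B μ y).le; have hm1 := gnMag_le_one hB μ y
  have hw0 := (gnW_pos μ y).le; have hw1 := gnW_le_one μ y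
  have e1 : |gnW' y p μ * gnMag B μ y| ≤ 12 * μ ^ 2 * ‖y‖ := by
    rw [abs_mul, abs_of_nonneg hm0]
    calc |gnW' y p μ| * gnMag B μ y ≤ 12 * μ ^ 2 * ‖y‖ * 1 := mul_le_mul h1 hm1 hm0 (by positivity)
      _ = _ := mul_one _
  have e2 : |gnW μ y * gnMag' y p B μ| ≤ 4 * B * (9 * μ ^ 4 * (μ ^ 2 * ‖y‖ ^ 5 + 2 * ‖y‖ ^ 3)) := by
    rw [abs_mul, abs_of_nonneg hw0]
    calc gnW μ y * |gnMag' y p B μ| ≤ 1 * (4 * B * (9 * μ ^ 4 * (μ ^ 2 * ‖y‖ ^ 5 + 2 * ‖y‖ ^ 3))) :=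
          mul_le_mul hw1 h2 (abs_nonneg _) zero_le_one
      _ = _ := one_mul _
  calc _ ≤ |gnW' y p μ * gnMag B μ y| + |gnW μ y * gnMag' y p B μ| := abs_add_le _ _
    _ ≤ 12 * μ ^ 2 * ‖y‖ + 4 * B * (9 * μ ^ 4 * (μ ^ 2 * ‖y‖ ^ 5 + 2 * ‖y‖ ^ 3)) := add_le_add e1 e2
    _ = _ := by ring

/-- `h` is differentiable. [folklore] -/
theorem differentiable_gnH (B μ : ℝ) : Differentiable ℝ (gnH B μ) :=
  (contDiff_gnH (n := 1) B μ).differentiable one_ne_zero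

/-- The partial `∂_p h(y)` IS the line derivative `gnH'`. [folklore] -/
theorem pderiv_gnH_eq (B μ : ℝ) : pderiv p (gnH B μ) y = gnH' y p B μ := by
  have h1 : HasLineDerivAt ℝ (gnH B μ) (pderiv p (gnH B μ) y) y (unitDir p) := hasLineDerivAt_pderiv (differentiable_gnH B μ) y p
  have h2 : HasLineDerivAt ℝ (gnH B μ) (gnH' y p B μ) y (unitDir p) := hasDerivAt_gnH_line y p B μ
  exact h1.unique h2

/-- **`|∂_p h(y)| ≤ gnLip B μ y`** for every coordinate direction `p` (`B ≥ 0`). [folklore] -/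
theorem abs_pderiv_gnH_le {B : ℝ} (hB : 0 ≤ B) (μ : ℝ) : |pderiv p (gnH B μ) y| ≤ gnLip B μ y := by
  rw [pderiv_gnH_eq]; exact abs_gnH'_le y p hB μ

end LineDeriv

/-! ### The gradient bounds -/

/-- **`‖∇h(y)‖² ≤ 9 · gnLip(y)²`**. [folklore] -/
theorem norm_gradient_gnH_sq_le {B : ℝ} (hB : 0 ≤ B) (μ : ℝ) (y : ZM) :
    ‖gradient (gnH B μ) y‖ ^ 2 ≤ 9 * gnLip B μ y ^ 2 := by
  rw [norm_gradient_sq]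
  calc ∑ p, pderiv p (gnH B μ) y ^ 2 ≤ ∑ _p : Fin 3 × Fin 3, gnLip B μ y ^ 2 := by
        refine Finset.sum_le_sum fun p _ => ?_
        have h := abs_pderiv_gnH_le y p hB μ
        have h0 := gnLip_nonneg hB μ y
        rw [← sq_abs]
        exact pow_le_pow_left₀ (abs_nonneg _) h 2
    _ = 9 * gnLip B μ y ^ 2 := by
        rw [Finset.sum_const, Finset.card_univ, Fintype.card_prod, Fintype.card_fin]; norm_num

/-- Elementary: `(a + b)² ≤ (1 + λ)a² + (1 + λ⁻¹)b²` for `λ > 0`. [folklore] -/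
theorem add_sq_le_weighted {lam : ℝ} (hlam : 0 < lam) (a b : ℝ) :
    (a + b) ^ 2 ≤ (1 + lam) * a ^ 2 + (1 + 1 / lam) * b ^ 2 := by
  have h : 0 ≤ (lam * a - b) ^ 2 / lam := by positivity
  have e : (1 + lam) * a ^ 2 + (1 + 1 / lam) * b ^ 2 - (a + b) ^ 2 = (lam * a - b) ^ 2 / lam := by
    field_simp; ring
  linarith [e]

/-- **Gradient bound for the quasimode integrand** `Φ = c·G·h`: for differentiable `G`, `B ≥ 0` and any `λ > 0`,
`‖∇Φ(y)‖² ≤ c² [(1+λ)‖∇G(y)‖² + (1+λ⁻¹)·G(y)²·9·gnLip(y)²]` (`0 < h ≤ 1`). [folklore] -/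
theorem norm_gradient_sq_mul_gnH_le {G : ZM → ℝ} (hG : Differentiable ℝ G) {B : ℝ} (hB : 0 ≤ B) (μ c : ℝ) {lam : ℝ}
    (hlam : 0 < lam) (y : ZM) :
    ‖gradient (fun z => c * (G z * gnH B μ z)) y‖ ^ 2 ≤
      c ^ 2 * ((1 + lam) * ‖gradient G y‖ ^ 2 + (1 + 1 / lam) * (G y ^ 2 * (9 * gnLip B μ y ^ 2))) := by
  have hh := differentiable_gnH B μ
  have hGh : Differentiable ℝ (fun z => G z * gnH B μ z) := hG.mul hh
  -- the partials of `Φ`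
  have hp : ∀ p, pderiv p (fun z => c * (G z * gnH B μ z)) y = c * (pderiv p G y * gnH B μ y + G y * pderiv p (gnH B μ) y) := by
    intro p
    have h1 := pderiv_mul (differentiable_const c) hGh p y
    have h2 := pderiv_mul hG hh p y
    have hc : pderiv p (fun _ : ZM => c) y = 0 := by simp [pderiv]
    have e1 : (fun z => c * (G z * gnH B μ z)) = (fun _ : ZM => c) * (fun z => G z * gnH B μ z) := by funext z; simp
    have e2 : (fun z => G z * gnH B μ z) = G * gnH B μ := rfl
    rw [e1, h1, hc, zero_mul, zero_add, e2, h2]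
  rw [norm_gradient_sq, norm_gradient_sq]
  simp_rw [hp]
  have hh0 := (gnH_pos B μ y).le; have hh1 := gnH_le_one hB μ y
  have key : ∀ p, (c * (pderiv p G y * gnH B μ y + G y * pderiv p (gnH B μ) y)) ^ 2 ≤
      c ^ 2 * ((1 + lam) * pderiv p G y ^ 2 + (1 + 1 / lam) * (G y ^ 2 * gnLip B μ y ^ 2)) := by
    intro p
    rw [mul_pow]
    refine mul_le_mul_of_nonneg_left ?_ (sq_nonneg c)
    have h1 := add_sq_le_weighted hlam (pderiv p G y * gnH B μ y) (G y * pderiv p (gnH B μ) y)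
    have h2 : (pderiv p G y * gnH B μ y) ^ 2 ≤ pderiv p G y ^ 2 := by
      rw [mul_pow]
      have : gnH B μ y ^ 2 ≤ 1 := by nlinarith
      nlinarith [sq_nonneg (pderiv p G y)]
    have h3 : (G y * pderiv p (gnH B μ) y) ^ 2 ≤ G y ^ 2 * gnLip B μ y ^ 2 := by
      rw [mul_pow]
      refine mul_le_mul_of_nonneg_left ?_ (sq_nonneg _)
      rw [← sq_abs]
      exact pow_le_pow_left₀ (abs_nonneg _) (abs_pderiv_gnH_le y p hB μ) 2
    have hl1 : 0 ≤ 1 + lam := by linarith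
    have hl2 : 0 ≤ 1 + 1 / lam := by positivity
    nlinarith [mul_le_mul_of_nonneg_left h2 hl1, mul_le_mul_of_nonneg_left h3 hl2]
  calc ∑ p, (c * (pderiv p G y * gnH B μ y + G y * pderiv p (gnH B μ) y)) ^ 2
      ≤ ∑ p, c ^ 2 * ((1 + lam) * pderiv p G y ^ 2 + (1 + 1 / lam) * (G y ^ 2 * gnLip B μ y ^ 2)) :=
        Finset.sum_le_sum fun p _ => key p
    _ = c ^ 2 * ((1 + lam) * ∑ p, pderiv p G y ^ 2 + (1 + 1 / lam) * (G y ^ 2 * (9 * gnLip B μ y ^ 2))) := by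
        rw [← Finset.mul_sum, Finset.sum_add_distrib, ← Finset.mul_sum, Finset.sum_const, Finset.card_univ,
          Fintype.card_prod, Fintype.card_fin, nsmul_eq_mul]
        push_cast
        ring

end Summit.QuantumFields.YangMills.Theorems.FemtoTransferGap

end
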